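import Summits.Langlands.Langlands.Theses.RamifiedCoefficientSeed
import Summits.Langlands.Langlands.Theorems.IrreducibilityBySelfDualityIrreducibleOffSectorOfWeak
import Literature.NumberTheory.Automorphic.ChebotarevArtinRepHolds
import Literature.NumberTheory.GaloisRepresentations.FramedRepEquivConj
import HarnessLib

/-!
# Birth skeleton (BC3) for crux stmt-Langlands-16781
`Summit.Langlands.Langlands.Theses.RamifiedCoefficientSeed.SectorComplement` — line `birth_RamifiedCoefficientSeed`

Route `route-Langlands-RamifiedCoefficientSeed` (deciding theorem
`closes : ExplicitRamifiedFamily → AdjointSeedFromDuality → AdjointLiftingGL3 → SectorComplement → _root_.Langlands`, rev 1).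
The crux is the route's JUNCTION item (rank 5, "OUT-OF-SCOPE REMAINDER = the rest of the summit"):

  `SectorComplement := NonPolarisableFamilyAutomorphic → _root_.Langlands`,

where `X := NonPolarisableFamilyAutomorphic` (the route TARGET, stmt-Langlands-16777) says: for some prime `p ≥ 11` there is an
infinite, pairwise twist-inequivalent family `f : ℕ → (Γ_ℚ → GL₃(ℚ̄_p))` of NON-essentially-self-dual representations every member of
which is Satake–Frobenius compatible a.e. with an L-algebraic cuspidal `π` on `GL₃(𝔸_ℚ)`.  Grounder + item text agree:
target-equivalent by design (`Langlands → SectorComplement := fun h _ => h`), open-problem, never staffed from this route; no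
`Disproof.lean` on the crux (`ledger crux ls stmt-Langlands-16781`, 2026-08-17).

File name. The crux directory `Cruxes/SectorComplement/` is SHARED by the homonymous cruxes of SkinnerWilesDefectOne (12923, NOTES.md),
HolomorphicShadow (14623, registered `Lines/birth.lean`) and MirrorPairReflection (12840, `Lines/birth_MirrorPairReflection.lean`); this
line is therefore published as `Lines/birth_RamifiedCoefficientSeed.lean` / `.md`, namespace `…Cruxes.SectorComplement.BirthRamifiedCoefficientSeed`.

## The skeleton: the item's own list of what the remainder IS, typed — W / B_w⁻ / B_w⁺ / LGC(∀ 𝓡) / 𝓡-existence / JS (2.2) / JS (2.3)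

The item text enumerates the remainder: "direction (A), every other (n, F), local–global compatibility at all places, the data 𝓡,
and all rank-3 motives outside the explicit family".  The seven stubs are exactly these, along the only typed decomposition of the
summit certified in the tree (crux-strategist of `CapacityClassicality.SectorToLanglands`, stmt-Langlands-10368; the landed decoupling
`ReciprocityUpToIrreducibility.reciprocityUpToIrreducibility_of_weak`, p116715; re-used by both sibling births in this directory):

* direction (A)  ↦ `stub_weakExistence` — W, Buzzard–Gee Conj. 3.2.2 weak form (a pinned-geometric avatar, Satake–Frobenius compatible
  a.e.); irreducibility of the avatar and uniqueness up to conjugacy are NOT assumed: they are PROVED below from B_w and Jacquet–Shalika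
  (the Rec-free pointwise bootstrap `IrreducibleOffSector.isIrreducible_of_geometric_of_weakAutomorphyBelow`, landed, + Chebotarev–
  Brauer–Nesbitt, `FramedGaloisRep.nonempty_equiv_of_hasFrobCharpolyAt_eventually chebotarev_artinRep_holds`);
* every other (n, F)  ↦ `stub_weakAutomorphyOffSector` — B_w (Fontaine–Mazur–Langlands, a.e. form) OFF the route's home sector
  `S₃ := [K:ℚ] = 1 ∧ n = 3 ∧ ρ not essentially self-dual` (X's own trace typing of "not essentially self-dual");
* rank 3 over ℚ outside the explicit family  ↦ `stub_nonSelfDualRankThreeAutomorphy` — B_w ON `S₃`: THE STUB IN WHOSE SECTOR X LIVES.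
  X is an `∃ p, ∃ f` statement: an existentially quantified witness family cannot be excised from a typed sector (a stub "B_w on S₃
  off the range of every admissible family" is B_w on S₃ again — apply it to the shifted family `m ↦ f (m+1)`), so X is honestly NOT
  load-bearing here, exactly as the item says ("trivially implied by Langlands … judge the route on cruxes 2–4"): the route's cruxes
  2–4 prove X, i.e. one infinite sub-family of this stub, and nothing in the complement;
* local–global compatibility at all places  ↦ `stub_pairCompatibility` — Taylor 2004 Conj. 7 at EVERY finite place for irreducible
  pinned-geometric a.e.-compatible pairs, for EVERY reciprocity datum `𝓡` (see "Statement shape" below);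
* the data 𝓡  ↦ `stub_reciprocityData` — `Nonempty (ReciprocityData K)` for every number field (Harris–Taylor 2001 Thm. A / Henniart
  2000 at every completion: a THEOREM of the literature, T0 debt `LocalLanglandsDatum.nonempty`);
* the analytic input of the (A)-side bootstrap  ↦ `stub_pairLBoundaryJS`, `stub_pairLPoleJS` — Arthur–Clozel Ch. 3 (2.2)/(2.3) for
  Borel–Jacquet data, the Literature named facts BY NAME (theorems of the literature, T0 debts; as in both sibling births).

`SectorComplement_of` (kernel-checked, no `sorry`; hypotheses = the seven stub statements by name via `_Goal.stub_x := type_of% @stub_x`;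
conclusion = the route decl BY NAME): B_w from its two halves by a case split on `S₃`; irreducibility of EVERY a.e.-compatible avatar of a
cuspidal `π` by the pointwise weak bootstrap (W's avatar + B_w below the rank + JS); (A) with uniqueness up to conjugacy and (B) with
local–global compatibility for EVERY `𝓡`; then the summit constant.

## Statement shape (`∀ 𝓡`, served)

The summit was re-typed during this registration (semantic-vacuity audit 2026-08-16 §2.11 row B, human ruling D-0032 Q-L1;
`Summits/Langlands/Langlands/Statement.lean` of 2026-08-17T04:35Z, served by the farm from ≈05:10Z):
`Langlands := ∀ F, Nonempty (ReciprocityData F) ∧ ∀ 𝓡 n, 0 < n → ∀ hcpt, GlobalLanglandsCorrespondenceGLn n F 𝓡 hcpt`, the local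
Artin normalisation of `𝓡` being PINNED (`ReciprocityData.llc_isCanonical`, `llc_eps_isCanonical`), in place of `∀ F, ∃ 𝓡, ∀ n, …`.
Accordingly LGC is typed for EVERY datum (`stub_pairCompatibility`, the `∀`-form of the sibling births' `∃ Rec` stub) and the
existence of data is its own stub (`stub_reciprocityData`, the summit's non-vacuity conjunct); the shape-independent core is
`globalLanglandsCorrespondenceGLn_of` (reciprocity for every datum), and only the last two lines of `SectorComplement_of` see the
summit's text.  Nothing is imported whose conclusion is the old `∃ 𝓡` text (in particular not
`…IrreducibleOffSectorLanglandsOfReciprocity`, used by the two sibling births, which the re-type invalidates): the (A)-side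
irreducibility comes from the Rec-free pointwise bootstrap `…IrreducibleOffSectorOfWeak`.

Disproof used: none exists for this crux item (crux dir: NOTES of 12923, births of 14623/12840, two crux ideas of other items; no
`Disproof.lean`; no landed `Theorems/SectorComplement/Negative/`).  Negatives index (`ledger negatives --problem Langlands`, 3 entries:
SplitPrimeInduction deinduction 16822, OrdinaryPrimeTransport Rankin–Selberg pole count 17212, K3 Serre-type anchor 3797): untouched.

References: K. Buzzard, T. Gee, LMS LNS 414 (2014), Conj. 3.2.1–3.2.2 [BuzzardGeeLMS2014]; J.-M. Fontaine, B. Mazur (1995), Conj. 1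
[FontaineMazurGeometric1995]; R. Taylor, Ann. Fac. Sci. Toulouse 13 (2004), Conj. 7–8 [TaylorGaloisRepresentations2004];
M. Harris, R. Taylor, Ann. Math. Stud. 151 (2001), Thm. A [HarrisTaylorAMS2001]; J. Arthur, L. Clozel, Ann. Math. Stud. 120, Ch. 3 §2
(2.2)–(2.3) [ArthurClozelAMS120]; H. Jacquet, J. Shalika, AJM 103 (1981) [JacquetShalikaAJM1981II]; F. Calegari, T. Gee,
Ann. Inst. Fourier 63 (2013) §1.1 [CalegariGee2013]; F. Calegari, ICM 2022 survey §11 [Calegari2023]; P. Allen et al. (ACC+),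
Ann. of Math. 197 (2023) §6 [ACCGHLNSTT2023].
-/

noncomputable section

set_option linter.dupNamespace false -- project-wide option; `Summit.Langlands.Langlands` is the mandated namespace

open scoped NumberField Classical Polynomial Topology
open Filter IsDedekindDomain Polynomial
open Literature.NumberTheory.Automorphic Literature.NumberTheory.GaloisRepresentations
open Summit.Langlands
open Summit.Langlands.Langlands.Theses.RamifiedCoefficientSeed (SectorComplement NonPolarisableFamilyAutomorphic)

namespace Summit.Langlands.Langlands.Cruxes.SectorComplement.BirthRamifiedCoefficientSeed

/-! ## 0. The crux, by name -/

/-- The crux IS `X → Langlands`, definitionally. [folklore] -/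
theorem sectorComplement_iff : SectorComplement ↔ (NonPolarisableFamilyAutomorphic → _root_.Langlands) :=
  Iff.rfl

/-! ## 1. The seven stubs (the ONLY sorries of this file) -/

/-- **stub W — weak existence** (Buzzard–Gee Conj. 3.2.2, weak form; direction (A) of the remainder; OPEN beyond regular algebraic
`π` over CM / totally real `K` — Harris–Lan–Taylor–Thorne 2016 Thm. A + Scholze 2015 V.4.2 give the avatar there, de Rham in the
crystalline range by A'Campo 2024 / Caraiani–Newton 2023; nothing for irregular `π` (NonRegularWeightBarrier) or for `K` neither CM nor
totally real (ShimuraVarietyRealizationBarrier)): every L-algebraic cuspidal `π` of `GL_n(𝔸_K)` has, for all `ℓ, ι`, SOME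
`ρ : Γ_K → GL_n(ℚ̄_ℓ)` unramified a.e., de Rham above `ℓ` for Fontaine's pinned datum, and Satake–Frobenius compatible with `π` a.e.
Verbatim the text of `CapacityClassicality.WeakExistence` and of both sibling births' `stub_weakExistence`.
Why it might fail: it is the existence half of (A) for all `n`, `K`.
[cite: BuzzardGeeLMS2014, Conj. 3.2.2] [cite: FontaineMazurGeometric1995, §1] [cite: HarrisLanTaylorThorneRMS2016, Thm. A] -/
theorem stub_weakExistence : ∀ (K : Type) [Field K] [NumberField K] (n : ℕ) (hcpt : Literature.NumberTheory.Automorphic.isCompact_glFiniteIntegralLevel n K), 0 < n → ∀ π : Literature.NumberTheory.Automorphic.CuspidalAutomorphicRepData n K hcpt, π.1.IsLAlgebraic → ∀ (ℓ : ℕ) [Fact ℓ.Prime] (ι : PadicAlgCl ℓ ≃+* ℂ), ∃ ρ : Literature.NumberTheory.GaloisRepresentations.FramedGaloisRep K (PadicAlgCl ℓ) n, ((∀ᶠ v : IsDedekindDomain.HeightOneSpectrum (NumberField.RingOfIntegers K) in Filter.cofinite, ρ.IsUnramifiedAt v) ∧ ∀ (v : IsDedekindDomain.HeightOneSpectrum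 (NumberField.RingOfIntegers K)) (hv : ((ℓ : ℕ) : NumberField.RingOfIntegers K) ∈ v.asIdeal), (Literature.NumberTheory.PAdicHodge.fontainePstAdicCompletion v ℓ hv).IsDeRhamFramed (ρ.toLocal v)) ∧ ∀ᶠ v : IsDedekindDomain.HeightOneSpectrum (NumberField.RingOfIntegers K) in Filter.cofinite, Summit.Langlands.SatakeFrobCompatibleAt ι π.1 ρ v := by
  sorry

/-- **stub B_w⁻ — weak automorphy OFF the home sector** ("every other (n, F)": Fontaine–Mazur 1995 Conj. 1 + Langlands, a.e. form,
for every `n ≥ 1` and every number field `K`, EXCEPT the sector `S₃ := [K:ℚ] = 1 ∧ n = 3 ∧ ρ not essentially self-dual` — the latter in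
the route's own trace typing `¬ ∃ χ, ∀ σ, tr ρ(σ⁻¹) = χ(σ) · tr ρ(σ)`; OPEN — known for `GL₁` (class field theory), odd `GL₂/ℚ`
(Khare–Wintenberger, Kisin, Emerton, Pan), regular Hodge–Tate weights under the automorphy-lifting provisos (BLGGT 2014 potential;
ACC+ 2023; Boxer–Calegari–Gee–Pilloni), and the essentially self-dual slice of `GL₃/ℚ` is `GL₂`-theory through `Ad⁰`/`Sym²`; open for
irregular weights, even `GL₂`, general `K`, `n ≥ 4` non-self-dual): every irreducible `ρ : Γ_K → GL_n(ℚ̄_ℓ)` unramified a.e. and de Rham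
above `ℓ` (pinned datum), NOT in `S₃`, has an L-algebraic cuspidal `π` Satake–Frobenius compatible a.e.
Why it might fail: it is (B) of the summit minus one sector (contains even icosahedral Artin `GL₂/ℚ`, all `K` neither CM nor totally real).
[cite: FontaineMazurGeometric1995, Conj. 1] [cite: BuzzardGeeLMS2014, Conj. 3.2.2] [cite: KhareWintenberger2009, Thm. 1.2]
[cite: BarnetlambEtAl2014, Thm. A] -/
theorem stub_weakAutomorphyOffSector : ∀ (K : Type) [Field K] [NumberField K] (n : ℕ) (hcpt : Literature.NumberTheory.Automorphic.isCompact_glFiniteIntegralLevel n K), 0 < n → ∀ (ℓ : ℕ) [Fact ℓ.Prime] (ι : PadicAlgCl ℓ ≃+* ℂ) (ρ : Literature.NumberTheory.GaloisRepresentations.FramedGaloisRep K (PadicAlgCl ℓ) n), ρ.toGaloisRep.IsIrreducible → ((∀ᶠ v : IsDedekindDomain.HeightOneSpectrum (NumberField.RingOfIntegers K) in Filter.cofinite, ρ.IsUnramifiedAt v) ∧ ∀ (v : IsDedekindDomain.HeightOneSpectrum (NumberField.RingOfIntegers K)) (hv : ((ℓ : ℕ) : NumberField.RingOfIntegers K)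 ∈ v.asIdeal), (Literature.NumberTheory.PAdicHodge.fontainePstAdicCompletion v ℓ hv).IsDeRhamFramed (ρ.toLocal v)) → ¬ (Module.finrank ℚ K = 1 ∧ n = 3 ∧ ¬ ∃ χ : Literature.NumberTheory.GaloisRepresentations.FramedGaloisRep K (PadicAlgCl ℓ) 1, ∀ σ, (ρ σ⁻¹).val.trace = (χ σ).val 0 0 * (ρ σ).val.trace) → ∃ π : Literature.NumberTheory.Automorphic.CuspidalAutomorphicRepData n K hcpt, π.1.IsLAlgebraic ∧ ∀ᶠ v : IsDedekindDomain.HeightOneSpectrum (NumberField.RingOfIntegers K) in Filter.cofinite, Summit.Langlands.SatakeFrobCompatibleAt ι π.1 ρ v := by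
  sorry

/-- **stub B_w⁺ — weak automorphy ON the home sector** ("all rank-3 motives outside the explicit family", and the family too: the
stub in whose sector X lives): over a number field `K` with `[K:ℚ] = 1`, every irreducible `ρ : Γ_K → GL₃(ℚ̄_ℓ)` unramified a.e., de Rham
above `ℓ` (pinned datum) and NOT essentially self-dual (`¬ ∃ χ, ∀ σ, tr ρ(σ⁻¹) = χ(σ) · tr ρ(σ)`) has an L-algebraic cuspidal `π` on
`GL₃(𝔸_K)` Satake–Frobenius compatible a.e.  OPEN: known in the regular (Hodge–Tate-distinct) case only POTENTIALLY (BLGGT is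
polarised; Qian 2022 potential automorphy for non-polarisable regular systems over an uncontrolled extension; ACC+ 2023 §6 automorphy
LIFTING in positive defect needs a residually automorphic seed — the route's cruxes 3–4 supply it on one explicit family with
`p ≥ 11`, Fontaine–Laffaille weights `{0,1,2}`, residual polarisation at a conjugation-ramified coefficient prime); in print only
isolated members are automorphic (van Geemen–Top surfaces, `E = ℚ(i)`: Ito–Koshikawa–Mieda 2018 by Faltings–Serre); nothing for
irregular weights (`λ`-adic avatars of non-self-dual cohomological `GL₃/ℚ` classes go the other way, (A)).
Why it might fail: it is Fontaine–Mazur–Langlands for non-polarisable rank 3 over ℚ — Calegari 2023 §11.1 "within reach" only in the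
regular case and only potentially; an irregular non-self-dual geometric `ρ` with no automorphic avatar would refute it (none known).
[cite: FontaineMazurGeometric1995, Conj. 1] [cite: Calegari2023, §11.1] [cite: ACCGHLNSTT2023, Thm. 6.1.1] [cite: Qian2022, Thm. 1.1]
[cite: ItoKoshikawaMieda2018, Thm. 1.1] -/
theorem stub_nonSelfDualRankThreeAutomorphy : ∀ (K : Type) [Field K] [NumberField K], Module.finrank ℚ K = 1 → ∀ (hcpt : Literature.NumberTheory.Automorphic.isCompact_glFiniteIntegralLevel 3 K) (ℓ : ℕ) [Fact ℓ.Prime] (ι : PadicAlgCl ℓ ≃+* ℂ) (ρ : Literature.NumberTheory.GaloisRepresentations.FramedGaloisRep K (PadicAlgCl ℓ) 3), ρ.toGaloisRep.IsIrreducible → ((∀ᶠ v : IsDedekindDomain.HeightOneSpectrum (NumberField.RingOfIntegers K) in Filter.cofinite, ρ.IsUnramifiedAt v) ∧ ∀ (v : IsDedekindDomain.HeightOneSpectrum (NumberField.RingOfIntegers K)) (hv : ((ℓ : ℕ) : NumberField.RingOfIntegers K) ∈ v.asIdeal), (Literature.NumberTheory.PAdicHodge.fontainePstAdicCompletion v ℓ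 hv).IsDeRhamFramed (ρ.toLocal v)) → (¬ ∃ χ : Literature.NumberTheory.GaloisRepresentations.FramedGaloisRep K (PadicAlgCl ℓ) 1, ∀ σ, (ρ σ⁻¹).val.trace = (χ σ).val 0 0 * (ρ σ).val.trace) → ∃ π : Literature.NumberTheory.Automorphic.CuspidalAutomorphicRepData 3 K hcpt, π.1.IsLAlgebraic ∧ ∀ᶠ v : IsDedekindDomain.HeightOneSpectrum (NumberField.RingOfIntegers K) in Filter.cofinite, Summit.Langlands.SatakeFrobCompatibleAt ι π.1 ρ v := by
  sorry

/-- **stub LGC — local–global compatibility at every finite place, for every reciprocity datum** ("local–global compatibility at all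
places": Taylor 2004 Conj. 7, `ι WD_v(ρ)^{F-ss} ≅ rec_v(π_v)` at EVERY finite `v` — the Grothendieck–Deligne recipe at `v ∤ ℓ`,
Fontaine's pinned `D_pst` at `v ∣ ℓ` — for every irreducible pinned-geometric `ρ` Satake–Frobenius compatible a.e. with an L-algebraic
cuspidal `π`, and for EVERY `𝓡 : ReciprocityData K` (the re-typed summit quantifies `∀ 𝓡` over Henniart-normalised data with PINNED
local Artin maps, on which all `rec_v` agree on generic classes — Henniart 1993 Thm. 1.1 —, so `∀ 𝓡` costs nothing in print; it is the
`∀`-form of the sibling births' `∃ Rec` stub `PairCompatibility`).  OPEN in general: known for regular algebraic conjugate-self-dual `π`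
over CM fields (Harris–Taylor, Taylor–Yoshida, Caraiani; Varma at `ℓ ≠ p` beyond), open for irregular `π` and at `v ∣ ℓ` in general.
Why it might fail: an a.e.-compatible irreducible pair with a local mismatch at a ramified place would refute it (none known); on
reciprocity data with a NON-canonical Artin normalisation (the pre-re-type structure) it could fail for ramified Hecke characters —
which is why the summit now pins the normalisation.
[cite: TaylorGaloisRepresentations2004, Conj. 7] [cite: HarrisTaylorAMS2001, Thm. A] [cite: BuzzardGeeLMS2014, Conj. 3.2.2] -/
theorem stub_pairCompatibility : ∀ (K : Type) [Field K] [NumberField K] (𝓡 : Summit.Langlands.ReciprocityData K) (n : ℕ) (hcpt : Literature.NumberTheory.Automorphic.isCompact_glFiniteIntegralLevel n K), 0 < n → ∀ (π : Literature.NumberTheory.Automorphic.CuspidalAutomorphicRepData n K hcpt), π.1.IsLAlgebraic → ∀ (ℓ : ℕ) [Fact ℓ.Prime] (ι : PadicAlgCl ℓ ≃+* ℂ) (ρ : Literature.NumberTheory.GaloisRepresentations.FramedGaloisRep K (PadicAlgCl ℓ) n), ρ.toGaloisRep.IsIrreducible → ((∀ᶠ v : IsDedekindDomain.HeightOneSpectrum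 (NumberField.RingOfIntegers K) in Filter.cofinite, ρ.IsUnramifiedAt v) ∧ ∀ (v : IsDedekindDomain.HeightOneSpectrum (NumberField.RingOfIntegers K)) (hv : ((ℓ : ℕ) : NumberField.RingOfIntegers K) ∈ v.asIdeal), (Literature.NumberTheory.PAdicHodge.fontainePstAdicCompletion v ℓ hv).IsDeRhamFramed (ρ.toLocal v)) → (∀ᶠ v : IsDedekindDomain.HeightOneSpectrum (NumberField.RingOfIntegers K) in Filter.cofinite, Summit.Langlands.SatakeFrobCompatibleAt ι π.1 ρ v) → ∀ v : IsDedekindDomain.HeightOneSpectrum (NumberField.RingOfIntegers K), Summit.Langlands.LocalGlobalCompatibleAt 𝓡 ι π.1 ρ v := by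
  sorry

/-- **stub 𝓡 — reciprocity data exist** ("the data 𝓡": at every finite place of every number field there is a local Langlands
datum for the general linear groups — Harris–Taylor 2001 Thm. A / Henniart 2000, normalised against THE local Artin map of local class
field theory; a THEOREM of the literature, in the tree the T0 named fact `LocalLanglandsDatum.nonempty` at each completion plus, for
the re-typed structure, the canonical pin `LocalArtinData.IsCanonical` / `canonicalArtin` of `LocalClassFieldTheory`).  It is the
non-vacuity conjunct `Nonempty (ReciprocityData F)` of the (re-typed, served) summit.
Why it might fail: only if the interface `LocalLanglandsDatum (K_v)` were unsatisfiable as typed (then the summit itself is false).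
[cite: HarrisTaylorAMS2001, Thm. A] [cite: SerreLocalFields1979, Ch. XIII §4 Thm. 1–2] -/
theorem stub_reciprocityData : ∀ (K : Type) [Field K] [NumberField K], Nonempty (Summit.Langlands.ReciprocityData K) := by
  sorry

/-- **stub JS (2.2)** — Jacquet–Shalika / Arthur–Clozel Ch. 3 (2.2) for Borel–Jacquet data, the Literature named fact BY NAME
(a THEOREM of the literature, T0 debt hanging on its `L²` leaves, `JacquetShalika1981_partialPairL_boundary_repData_of_L2_leaves`;
= item stmt-Langlands-13622 `IrreducibilityBySelfDuality.PairLBoundaryJS` definitionally).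
[cite: ArthurClozelAMS120, Ch. 3 §2 (2.2)] [cite: JacquetShalikaAJM1981II, Prop. 3.6 and Thm. 4.4] -/
theorem stub_pairLBoundaryJS : Literature.NumberTheory.Automorphic.JacquetShalika1981_partialPairL_boundary_repData := by
  sorry

/-- **stub JS (2.3)** — Jacquet–Shalika / Arthur–Clozel Ch. 3 (2.3) for Borel–Jacquet data, the Literature named fact BY NAME
(a THEOREM of the literature; T0 debt on one `L²` leaf, `JacquetShalika1981_partialPairL_pole_repData_of_pole_of_eq_conj`; ranks 1, 2
proved in the tree).
[cite: ArthurClozelAMS120, Ch. 3 §2 (2.3)] [cite: JacquetShalikaAJM1981II, Prop. 3.6] -/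
theorem stub_pairLPoleJS : Literature.NumberTheory.Automorphic.JacquetShalika1981_partialPairL_pole_repData := by
  sorry

/-! ## 2. The stub statements as named propositions (hypotheses of the composition, admissible by stub name)

Each `_Goal.stub_x` is `type_of% @stub_x`: literally the stub's statement, no text duplicated, no `sorry` inherited. -/

namespace _Goal

/-- The statement of `stub_weakExistence` (literally its type). [folklore] -/
def stub_weakExistence : Prop :=
  type_of% @Summit.Langlands.Langlands.Cruxes.SectorComplement.BirthRamifiedCoefficientSeed.stub_weakExistence

/-- The statement of `stub_weakAutomorphyOffSector` (literally its type). [folklore] -/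
def stub_weakAutomorphyOffSector : Prop :=
  type_of% @Summit.Langlands.Langlands.Cruxes.SectorComplement.BirthRamifiedCoefficientSeed.stub_weakAutomorphyOffSector

/-- The statement of `stub_nonSelfDualRankThreeAutomorphy` (literally its type). [folklore] -/
def stub_nonSelfDualRankThreeAutomorphy : Prop :=
  type_of% @Summit.Langlands.Langlands.Cruxes.SectorComplement.BirthRamifiedCoefficientSeed.stub_nonSelfDualRankThreeAutomorphy

/-- The statement of `stub_pairCompatibility` (literally its type). [folklore] -/
def stub_pairCompatibility : Prop :=
  type_of% @Summit.Langlands.Langlands.Cruxes.SectorComplement.BirthRamifiedCoefficientSeed.stub_pairCompatibility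

/-- The statement of `stub_reciprocityData` (literally its type). [folklore] -/
def stub_reciprocityData : Prop :=
  type_of% @Summit.Langlands.Langlands.Cruxes.SectorComplement.BirthRamifiedCoefficientSeed.stub_reciprocityData

/-- The statement of `stub_pairLBoundaryJS` (literally its type). [folklore] -/
def stub_pairLBoundaryJS : Prop :=
  type_of% @Summit.Langlands.Langlands.Cruxes.SectorComplement.BirthRamifiedCoefficientSeed.stub_pairLBoundaryJS

/-- The statement of `stub_pairLPoleJS` (literally its type). [folklore] -/
def stub_pairLPoleJS : Prop :=
  type_of% @Summit.Langlands.Langlands.Cruxes.SectorComplement.BirthRamifiedCoefficientSeed.stub_pairLPoleJS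

end _Goal

/-! ## 3. The composition (kernel-checked, no `sorry`):
W → B_w⁻ → B_w⁺ → LGC(∀ 𝓡) → 𝓡-existence → JS (2.2) → JS (2.3) → SectorComplement -/

/-- **Reciprocity for every datum, from the seven stubs** — the shape-independent core: for every number field `F` and EVERY
`𝓡 : ReciprocityData F`, `GlobalLanglandsCorrespondenceGLn n F 𝓡 hcpt` for all `n ≥ 1`.  B_w is rebuilt from its two halves by a case
split on the home sector `S₃`; every a.e.-compatible avatar of an L-algebraic cuspidal `π` is irreducible by the pointwise weak
bootstrap (W's pinned-geometric avatar, B_w strictly below the rank, Jacquet–Shalika (2.2)–(2.3):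
`IrreducibleOffSector.isIrreducible_of_geometric_of_weakAutomorphyBelow`, landed); (A) then follows with uniqueness up to conjugacy
(irreducible ⇒ semisimple; equal Satake parameters a.e. ⇒ equal Frobenius polynomials a.e. ⇒ equivalent by Chebotarev +
Brauer–Nesbitt ⇒ conjugate), and (B) is B_w plus LGC for the datum at hand.
[cite: BuzzardGeeLMS2014, Conj. 3.2.1 and Conj. 3.2.2] [cite: CalegariGee2013, §1.1] [cite: DeligneSerreASENS1974, Lemme 3.2] -/
theorem globalLanglandsCorrespondenceGLn_of (hW : _Goal.stub_weakExistence) (hOff : _Goal.stub_weakAutomorphyOffSector)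
    (hOn : _Goal.stub_nonSelfDualRankThreeAutomorphy) (hL : _Goal.stub_pairCompatibility)
    (hJSb : _Goal.stub_pairLBoundaryJS) (hJSp : _Goal.stub_pairLPoleJS) :
    ∀ (F : Type) [Field F] [NumberField F] (𝓡 : ReciprocityData F) (n : ℕ), 0 < n →
      ∀ hcpt : isCompact_glFiniteIntegralLevel n F, GlobalLanglandsCorrespondenceGLn n F 𝓡 hcpt := by
  dsimp only [_Goal.stub_weakExistence, _Goal.stub_weakAutomorphyOffSector, _Goal.stub_nonSelfDualRankThreeAutomorphy,
    _Goal.stub_pairCompatibility, _Goal.stub_pairLBoundaryJS, _Goal.stub_pairLPoleJS] at hW hOff hOn hL hJSb hJSp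
  -- B_w (Fontaine–Mazur–Langlands, a.e. form) from its two halves: case split on the home sector S₃
  have hB : ∀ (K : Type) [Field K] [NumberField K] (n : ℕ) (hcpt : Literature.NumberTheory.Automorphic.isCompact_glFiniteIntegralLevel n K), 0 < n → ∀ (ℓ : ℕ) [Fact ℓ.Prime] (ι : PadicAlgCl ℓ ≃+* ℂ) (ρ : Literature.NumberTheory.GaloisRepresentations.FramedGaloisRep K (PadicAlgCl ℓ) n), ρ.toGaloisRep.IsIrreducible → ((∀ᶠ v : IsDedekindDomain.HeightOneSpectrum (NumberField.RingOfIntegers K) in Filter.cofinite, ρ.IsUnramifiedAt v) ∧ ∀ (v : IsDedekindDomain.HeightOneSpectrum (NumberField.RingOfIntegers K)) (hv : ((ℓ : ℕ) : NumberField.RingOfIntegers K) ∈ v.asIdeal), (Literature.NumberTheory.PAdicHodge.fontainePstAdicCompletion v ℓ hv).IsDeRhamFramed (ρ.toLocal v)) → ∃ π : Literature.NumberTheory.Automorphic.CuspidalAutomorphicRepData n K hcpt, π.1.IsLAlgebraic ∧ ∀ᶠ v : IsDedekindDomain.HeightOneSpectrum (NumberField.RingOfIntegers K) in Filter.cofinite,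 Summit.Langlands.SatakeFrobCompatibleAt ι π.1 ρ v := by
    intro K _ _ n hcpt hn ℓ _ ι ρ hirr hgeo
    by_cases hs : (Module.finrank ℚ K = 1 ∧ n = 3 ∧ ¬ ∃ χ : Literature.NumberTheory.GaloisRepresentations.FramedGaloisRep K (PadicAlgCl ℓ) 1, ∀ σ, (ρ σ⁻¹).val.trace = (χ σ).val 0 0 * (ρ σ).val.trace)
    · obtain ⟨hK, rfl, hnsd⟩ := hs
      exact hOn K hK hcpt ℓ ι ρ hirr hgeo hnsd
    · exact hOff K n hcpt hn ℓ ι ρ hirr hgeo hs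
  -- irreducibility of EVERY a.e.-compatible avatar of an L-algebraic cuspidal π: the pointwise weak bootstrap (Rec-free)
  have irr : ∀ (K : Type) [Field K] [NumberField K] (n : ℕ) (hcpt : isCompact_glFiniteIntegralLevel n K)
      (_ : 0 < n) (π : CuspidalAutomorphicRepData n K hcpt), π.1.IsLAlgebraic → ∀ (ℓ : ℕ) [Fact ℓ.Prime]
      (ι : PadicAlgCl ℓ ≃+* ℂ) (ρ : FramedGaloisRep K (PadicAlgCl ℓ) n),
      (∀ᶠ v : HeightOneSpectrum (𝓞 K) in cofinite, SatakeFrobCompatibleAt ι π.1 ρ v) →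
        ρ.toGaloisRep.IsIrreducible := by
    intro K _ _ n hcpt hn π hLalg ℓ _ ι ρ hρ
    obtain ⟨ρ₀, hgeo₀, hρ₀⟩ := hW K n hcpt hn π hLalg ℓ ι
    refine Summit.Langlands.Langlands.Theorems.IrreducibleOffSector.isIrreducible_of_geometric_of_weakAutomorphyBelow
      hJSb hJSp hn π ι hgeo₀ hρ₀ ?_ ρ hρ
    intro m hm _ hmcpt r hrirr hrgeo
    obtain ⟨σ, -, hσ⟩ := hB K m hmcpt hm ℓ ι r hrirr hrgeo
    exact ⟨σ, hσ⟩
  -- (A) with uniqueness up to conjugacy, and (B) with local–global compatibility, for the datum at hand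
  intro F _ _ 𝓡 n hn hcpt
  refine ⟨?_, ?_⟩
  · intro π hLalg ℓ _ ι
    obtain ⟨ρ, hgeo, hcorr⟩ := hW F n hcpt hn π hLalg ℓ ι
    have h1 : ρ.toGaloisRep.IsIrreducible := irr F n hcpt hn π hLalg ℓ ι ρ hcorr
    refine ⟨ρ, h1, hgeo, ⟨hcorr, hL F 𝓡 n hcpt hn π hLalg ℓ ι ρ h1 hgeo hcorr⟩, fun ρ' hcorr' => ?_⟩
    -- uniqueness: irreducible ⇒ semisimple; equal Satake parameters a.e. (Flath) ⇒ equal Frobenius polynomials a.e.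
    -- ⇒ equivalent (Chebotarev + Brauer–Nesbitt) ⇒ conjugate
    have h2 : ρ'.toGaloisRep.IsIrreducible := irr F n hcpt hn π hLalg ℓ ι ρ' hcorr'.1
    have hs1 : ρ.toGaloisRep.IsSemisimple := by
      haveI := h1
      change ComplementedLattice _
      infer_instance
    have hs2 : ρ'.toGaloisRep.IsSemisimple := by
      haveI := h2
      change ComplementedLattice _
      infer_instance
    have hev : ∀ᶠ v : HeightOneSpectrum (𝓞 F) in cofinite,
        ρ.IsUnramifiedAt v ∧ ρ'.IsUnramifiedAt v ∧
          ∃ P : Polynomial (PadicAlgCl ℓ), ρ.HasFrobCharpolyAt v P ∧ ρ'.HasFrobCharpolyAt v P := by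
      filter_upwards [hcorr, hcorr'.1] with v hv hv'
      obtain ⟨α, hα, hur, hcp⟩ := hv
      obtain ⟨α', hα', hur', hcp'⟩ := hv'
      obtain rfl : α = α' := AutomorphicRepData.hasSatakeParamAt_unique_holds π.1 hα hα'
      exact ⟨hur, hur', _, hcp, hcp'⟩
    obtain ⟨e⟩ := FramedGaloisRep.nonempty_equiv_of_hasFrobCharpolyAt_eventually
      chebotarev_artinRep_holds ρ ρ' hs1 hs2 hev
    obtain ⟨P, hP⟩ := FramedRep.exists_eq_conj_of_equiv ρ ρ' e
    exact ⟨P, hP.symm⟩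
  · intro ℓ _ ι ρ hirr hgeo
    obtain ⟨π, hLalg, hρ⟩ := hB F n hcpt hn ℓ ι ρ hirr hgeo
    exact ⟨π, hLalg, hρ, hL F 𝓡 n hcpt hn π hLalg ℓ ι ρ hirr hgeo hρ⟩

/-- **`SectorComplement` from its seven stubs.**  `X` (the route target) is introduced and not used — it is one infinite family
inside the sector of `stub_nonSelfDualRankThreeAutomorphy` and cannot be excised from a typed sector (see the module docstring);
then reciprocity for every datum (`globalLanglandsCorrespondenceGLn_of`) and the existence of data (`stub_reciprocityData`) are
the two conjuncts of the served summit text `∀ F, Nonempty (ReciprocityData F) ∧ ∀ 𝓡 n, 0 < n → ∀ hcpt, …`.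
Hypotheses = the seven stub statements by name; conclusion = the route decl by name.
[cite: BuzzardGeeLMS2014, Conj. 3.2.1 and Conj. 3.2.2] [cite: FontaineMazurGeometric1995, Conj. 1] [cite: HarrisTaylorAMS2001, Thm. A] -/
theorem SectorComplement_of (hW : _Goal.stub_weakExistence) (hOff : _Goal.stub_weakAutomorphyOffSector)
    (hOn : _Goal.stub_nonSelfDualRankThreeAutomorphy) (hL : _Goal.stub_pairCompatibility)
    (hRD : _Goal.stub_reciprocityData) (hJSb : _Goal.stub_pairLBoundaryJS) (hJSp : _Goal.stub_pairLPoleJS) :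
    SectorComplement := by
  rw [sectorComplement_iff]
  intro _hX
  have hG := globalLanglandsCorrespondenceGLn_of hW hOff hOn hL hJSb hJSp
  dsimp only [_Goal.stub_reciprocityData] at hRD
  intro F _ _
  exact ⟨hRD F, fun 𝓡 => hG F 𝓡⟩

/-- By-name sanity check (an `example`, not a declaration): the seven stubs feed the composition as they stand. -/
example : SectorComplement :=
  SectorComplement_of stub_weakExistence stub_weakAutomorphyOffSector stub_nonSelfDualRankThreeAutomorphy
    stub_pairCompatibility stub_reciprocityData stub_pairLBoundaryJS stub_pairLPoleJS

end Summit.Langlands.Langlands.Cruxes.SectorComplement.BirthRamifiedCoefficientSeed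

end
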